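import Literature.AlgebraicGeometry.Resolution.AlterationsDescentLimit
import Literature.AlgebraicGeometry.Resolution.AlterationsDescentStage
import Literature.AlgebraicGeometry.Resolution.StrictNormalCrossingsFlatDescent
import HarnessLib

/-!
# De Jong 1996, 4.5: the limit argument, II — the final stage

Topic: `Literature/AlgebraicGeometry/Resolution`. Continuation of `AlterationsDescentLimit.lean`
(`DeJong1996.Descent45.Setup`, stages `s₀ ⊆ iC ⊆ jD`). Here we choose the final stage `t`
(below `jD`, the stage `jE` where the étale locus of `φ̄₁` descends, the stage `iH` where the
reduced structure of the boundary `B̄` descends and the stages where the closures of the finitely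
many maximal points of `B̄` descend — all by Görtz–Wedhorn I, Prop. 10.75 (1) / Thm. 10.57 in the
form of `Literature.AlgebraicGeometry.Limits.exists_comap_map_eq` and Mathlib's
`exists_preimage_eq`), define the data over `k(t)` — `E_t ⊇ U_t`, `X'_t`, `φ_t : U_t → X'_t` —
and prove that its base change along `Spec K → Spec k(t)` is the data over `K`
(`Setup.isPullback_φf`), whence (`AlterationsDescentStage.lean`) `φ_t` is a generically étale
alteration between integral schemes and `E_t` is integral and regular.

## References

* A. J. de Jong, *Smoothness, semi-stability and alterations*, Publ. Math. IHÉS 83 (1996), 4.5.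
* U. Görtz, T. Wedhorn, *Algebraic Geometry I* (2020), (10.13), Thm. 10.57, 10.63, Prop. 10.75.
-/

noncomputable section

universe u

open CategoryTheory CategoryTheory.Limits AlgebraicGeometry TopologicalSpace
  Literature.AlgebraicGeometry.Limits Literature.AlgebraicGeometry.Limits.FieldExt
  Literature.AlgebraicGeometry.Motives Scheme.IdealSheafData

namespace Literature.AlgebraicGeometry.Resolution

namespace DeJong1996.Descent45

set_option backward.isDefEq.respectTransparency false

variable {k K : Type u} [Field k] [Field K] [Algebra k K]

namespace Setup

variable (S : Setup k K)

/-! ## Generalities -/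

/-- An isomorphism followed by an alteration is an alteration (a private copy of
`IsAlteration.iso_comp` of `AlterationsPreSemiStablePullback.lean`, to keep imports small).
[folklore] -/
private theorem isAlteration_iso_comp {A B C : Scheme.{u}}
    (e : A ⟶ B) [IsIso e] {φ : B ⟶ C} (h : IsAlteration φ) : IsAlteration (e ≫ φ) := by
  haveI := h.isIntegral
  haveI := h.isProper
  haveI := h.isDominant
  haveI : IsIntegral A := by
    haveI : Nonempty A := ⟨inv e (Classical.arbitrary B)⟩
    exact isIntegral_of_isOpenImmersion e
  obtain ⟨U, hU, hfin⟩ := h.exists_isFinite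
  haveI := hfin
  refine ⟨‹_›, inferInstance, inferInstance, U, hU, ?_⟩
  rw [morphismRestrict_comp]
  infer_instance

/-! ## The boundary `B̄` and its maximal points -/

/-- The boundary `B̄ = j₁(φ₁⁻¹(Z̄')) ∪ (X̄̄₁ ∖ j₁(X₁))`. [cite: DeJong1996, Thm. 4.1 (ii), p. 66] -/
abbrev Bbar : Set S.Xbar₁ :=
  S.j₁ '' (S.φ₁ ⁻¹' ((S.ιb ≫ pullback.snd (Spec.map (σ₁ k K)) S.f) ⁻¹' S.Z)) ∪ (Set.range S.j₁)ᶜ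

/-- `B̄` is closed. [folklore] -/
theorem isClosed_Bbar : IsClosed S.Bbar := S.isSNC.isClosed

/-- `e₁⁻¹ ⁻¹' B̄ = e₁ '' B̄ ⊆ E_K`. [folklore] -/
abbrev BbarK : Closeds S.cE.pt := ⟨S.e₁.inv ⁻¹' S.Bbar, S.isClosed_Bbar.preimage S.e₁.inv.continuous⟩

/-- `E_K` is a Noetherian scheme. [folklore] -/
instance isNoetherian_cE_pt : IsNoetherian S.cE.pt := {}

/-- The maximal points of a subset `C` (generic points of its irreducible components).
[folklore] -/
abbrev maxPts {T : Type u} [TopologicalSpace T] (C : Set T) : Set T :=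
  {η | η ∈ C ∧ ∀ η' ∈ C, η' ⤳ η → η' = η}

/-- **A closed subset of a Noetherian sober space has finitely many maximal points** (they are
the generic points of its irreducible components). [folklore] -/
theorem finite_maxPts {T : Type u} [TopologicalSpace T] [NoetherianSpace T] [QuasiSober T]
    [T0Space T] {C : Set T} (hC : IsClosed C) : (maxPts C).Finite := by
  -- the closed subspace `C` is Noetherian and sober, with finitely many irreducible components
  haveI : QuasiSober C := hC.isClosedEmbedding_subtypeVal.quasiSober
  have hfin : (irreducibleComponents C).Finite := NoetherianSpace.finite_irreducibleComponents
  haveI := hfin.to_subtype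
  -- `η ↦ closure {η}` injects the maximal points into the irreducible components of `C`
  have hmem : ∀ η : maxPts C, closure {(⟨η.1, η.2.1⟩ : C)} ∈ irreducibleComponents C := by
    intro η
    refine ⟨isIrreducible_singleton.closure, fun t ht hle => ?_⟩
    let γ : C := ht.genericPoint
    have hγ : IsGenericPoint γ (closure t) := ht.isGenericPoint_genericPoint_closure
    have hx : (⟨η.1, η.2.1⟩ : C) ∈ closure t :=
      subset_closure (hle (subset_closure (Set.mem_singleton _)))
    have hγx : γ ⤳ (⟨η.1, η.2.1⟩ : C) := hγ.specializes hx
    have hγη : (γ : T) ⤳ η.1 := hγx.map continuous_subtype_val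
    have heq : (γ : T) = η.1 := η.2.2 γ.1 γ.2 hγη
    have hγeq : γ = ⟨η.1, η.2.1⟩ := Subtype.ext heq
    calc t ⊆ closure t := subset_closure
      _ = closure {γ} := hγ.def.symm
      _ = closure {(⟨η.1, η.2.1⟩ : C)} := by rw [hγeq]
  let F : maxPts C → irreducibleComponents C := fun η => ⟨_, hmem η⟩
  have hF : Function.Injective F := by
    intro η₁ η₂ h
    have h' : closure {(⟨η₁.1, η₁.2.1⟩ : C)} = closure {(⟨η₂.1, η₂.2.1⟩ : C)} :=
      congrArg Subtype.val h
    have h1 : IsGenericPoint (⟨η₁.1, η₁.2.1⟩ : C) (closure {(⟨η₂.1, η₂.2.1⟩ : C)}) :=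
      h' ▸ isGenericPoint_closure
    have h2 := h1.eq isGenericPoint_closure
    have h3 : η₁.1 = η₂.1 := congrArg (fun z : C => (z : T)) h2
    exact Subtype.ext h3
  haveI : Finite (maxPts C) := Finite.of_injective F hF
  exact Set.toFinite _

/-- The maximal points of `B̄ ⊆ E_K` are finite in number. [folklore] -/
theorem finite_maxPts_BbarK : (maxPts (S.BbarK : Set S.cE.pt)).Finite :=
  finite_maxPts S.BbarK.isClosed

/-! ## The remaining stages -/

/-- The leg `E_K → E_j` of the level-two cone. [folklore] -/
abbrev leg (j : (Idx K S.t₀)ᵒᵖ) : S.cE.pt ⟶ S.E.obj j := (S.cE.π.app j : S.cE.pt ⟶ S.E.obj j)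

/-- A stage from which on the reduced structure of `B̄` descends (Görtz–Wedhorn I,
Prop. 10.75 (1), ideal form `exists_comap_map_eq`). [cite: GortzWedhorn2020, Prop. 10.75 (1), p. 333] -/
theorem exists_iH : ∃ i : (Idx K S.t₀)ᵒᵖ, ∀ (j : (Idx K S.t₀)ᵒᵖ) (_ : j ⟶ i),
    ((vanishingIdeal S.BbarK).map (S.leg j)).comap (S.leg j) = vanishingIdeal S.BbarK :=
  exists_comap_map_eq S.E S.cE S.isLimit_cE _ fun U => by
    haveI := IsLocallyNoetherian.component_noetherian (X := S.cE.pt) U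
    exact IsNoetherian.noetherian _

/-- The stage `iH`. [cite: GortzWedhorn2020, Prop. 10.75 (1), p. 333] -/
def iH : (Idx K S.t₀)ᵒᵖ := S.exists_iH.choose

/-- The defining property of `iH`. [folklore] -/
theorem iH_spec (j : (Idx K S.t₀)ᵒᵖ) (φ : j ⟶ S.iH) :
    ((vanishingIdeal S.BbarK).map (S.leg j)).comap (S.leg j) = vanishingIdeal S.BbarK :=
  S.exists_iH.choose_spec j φ

/-- For each maximal point `η` of `B̄`, a stage from which on the reduced structure of `cl{η}`
descends. [cite: GortzWedhorn2020, Prop. 10.75 (1), p. 333] -/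
theorem exists_iη (η : S.cE.pt) : ∃ i : (Idx K S.t₀)ᵒᵖ, ∀ (j : (Idx K S.t₀)ᵒᵖ) (_ : j ⟶ i),
    ((vanishingIdeal ⟨closure {η}, isClosed_closure⟩).map (S.leg j)).comap (S.leg j) =
      vanishingIdeal ⟨closure {η}, isClosed_closure⟩ :=
  exists_comap_map_eq S.E S.cE S.isLimit_cE _ fun U => by
    haveI := IsLocallyNoetherian.component_noetherian (X := S.cE.pt) U
    exact IsNoetherian.noetherian _

/-- A common stage for the (finitely many) maximal points of `B̄`. [folklore] -/
theorem exists_iM : ∃ i : (Idx K S.t₀)ᵒᵖ, ∀ η ∈ maxPts (S.BbarK : Set S.cE.pt),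
    ∀ (j : (Idx K S.t₀)ᵒᵖ) (_ : j ⟶ i),
      ((vanishingIdeal ⟨closure {η}, isClosed_closure⟩).map (S.leg j)).comap (S.leg j) =
        vanishingIdeal ⟨closure {η}, isClosed_closure⟩ := by
  haveI := S.finite_maxPts_BbarK.to_subtype
  choose i hi using fun η : maxPts (S.BbarK : Set S.cE.pt) => S.exists_iη η.1
  obtain ⟨i₀, hi₀⟩ := exists_le_of_finite K S.t₀ i
  refine ⟨i₀, fun η hη j φ => hi ⟨η, hη⟩ j (φ ≫ (hi₀ ⟨η, hη⟩).some)⟩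

/-- The stage `iM`. [folklore] -/
def iM : (Idx K S.t₀)ᵒᵖ := S.exists_iM.choose

/-- The defining property of `iM`. [folklore] -/
theorem iM_spec {η : S.cE.pt} (hη : η ∈ maxPts (S.BbarK : Set S.cE.pt)) (j : (Idx K S.t₀)ᵒᵖ)
    (φ : j ⟶ S.iM) :
    ((vanishingIdeal ⟨closure {η}, isClosed_closure⟩).map (S.leg j)).comap (S.leg j) =
      vanishingIdeal ⟨closure {η}, isClosed_closure⟩ :=
  S.exists_iM.choose_spec η hη j φ

/-- The isomorphism `V̄ ≅ X₁` from the cone point of the diagram of preimages. [folklore] -/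
def Ψ : S.ocone.pt ≅ S.X₁ := S.cE.pt.isoOfEq S.preimage_VC ≪≫ S.VbarIso

/-- `aD = Ψ ≫ φ₁ ≫ (X̄' → X'₀)` (by `rfl`). [folklore] -/
theorem aD_eq : S.aD = S.Ψ.hom ≫ S.φ₁ ≫ S.toX'₀ := by
  simp only [aD, Ψ, Iso.trans_hom, Category.assoc]

/-- `X₁` is a Noetherian scheme. [folklore] -/
instance isNoetherian_X₁ : IsNoetherian S.X₁ := by
  haveI := S.isAlteration_φ₁.isProper
  haveI : IsLocallyNoetherian S.Xb := LocallyOfFiniteType.isLocallyNoetherian S.gb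
  haveI : IsLocallyNoetherian S.X₁ := LocallyOfFiniteType.isLocallyNoetherian S.φ₁
  exact {}

/-- The étale locus transported to the cone point of the diagram of preimages. [folklore] -/
abbrev Wpre : S.ocone.pt.Opens := S.Ψ.hom ⁻¹ᵁ S.W₁

/-- `Wpre` is quasi-compact. [folklore] -/
theorem isCompact_Wpre : IsCompact (S.Wpre : Set S.ocone.pt) := by
  have h1 : IsCompact (S.W₁ : Set S.X₁) := NoetherianSpace.isCompact _
  have h2 : (S.Wpre : Set S.ocone.pt) = S.Ψ.inv '' (S.W₁ : Set S.X₁) := by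
    ext x
    constructor
    · intro hx
      refine ⟨S.Ψ.hom x, hx, ?_⟩
      rw [← Scheme.Hom.comp_apply, Iso.hom_inv_id]; rfl
    · rintro ⟨y, hy, rfl⟩
      change S.Ψ.hom (S.Ψ.inv y) ∈ S.W₁
      rw [← Scheme.Hom.comp_apply, Iso.inv_hom_id]
      exact hy
  rw [h2]
  exact h1.image S.Ψ.inv.continuous

/-- A stage `jE` and an open `W_E` descending the étale locus. [cite: GortzWedhorn2020, Thm. 10.57 (2), p. 325] -/
theorem exists_jE : ∃ (j : Over S.iC) (W : (S.OD.obj j).Opens), IsCompact (W : Set (S.OD.obj j)) ∧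
    S.ocone.π.app j ⁻¹ᵁ W = S.Wpre :=
  exists_preimage_eq S.OD S.ocone S.isLimit_ocone S.Wpre S.isCompact_Wpre

/-- The stage `jE`. [folklore] -/
def jE : Over S.iC := S.exists_jE.choose

/-- The descended open `W_E`. [folklore] -/
def WE : (S.OD.obj S.jE).Opens := S.exists_jE.choose_spec.choose

/-- `W_E` pulls back to the étale locus. [folklore] -/
theorem preimage_WE : S.ocone.π.app S.jE ⁻¹ᵁ S.WE = S.Wpre := S.exists_jE.choose_spec.choose_spec.2

/-! ## The final stage -/

/-- **The final stage `tf`**: below `jD`, `jE`, `iH` and `iM`. [folklore] -/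
def tf : (Idx K S.t₀)ᵒᵖ :=
  IsCofiltered.min (IsCofiltered.min S.jD.left S.jE.left) (IsCofiltered.min S.iH S.iM)

/-- `tf → jD.left`. [folklore] -/
def tfD : S.tf ⟶ S.jD.left := IsCofiltered.minToLeft _ _ ≫ IsCofiltered.minToLeft _ _

/-- `tf → jE.left`. [folklore] -/
def tfE : S.tf ⟶ S.jE.left := IsCofiltered.minToLeft _ _ ≫ IsCofiltered.minToRight _ _

/-- `tf → iH`. [folklore] -/
def tfH : S.tf ⟶ S.iH := IsCofiltered.minToRight _ _ ≫ IsCofiltered.minToLeft _ _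

/-- `tf → iM`. [folklore] -/
def tfM : S.tf ⟶ S.iM := IsCofiltered.minToRight _ _ ≫ IsCofiltered.minToRight _ _

/-- The final stage as an object over `iC`. [folklore] -/
def jf : Over S.iC := Over.mk (S.tfD ≫ S.jD.hom)

/-- `jf → jD`. [folklore] -/
def jfD : S.jf ⟶ S.jD := Over.homMk S.tfD rfl

/-- `jf → jE`. [folklore] -/
def jfE : S.jf ⟶ S.jE := Over.homMk S.tfE (Subsingleton.elim _ _)

/-- The field `k₁ = k(tf)` of the final stage, as an object of `CommRingCat`. [folklore] -/
abbrev kf : CommRingCat.{u} := (ringDiagram k K S.t₀).obj S.tf.unop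

/-- `E_f = E_{tf}`, the compactification at the final stage. [folklore] -/
abbrev Ef : Scheme.{u} := S.E.obj S.tf

/-- `U_f ⊆ E_f`, the preimage of `V_C`. [folklore] -/
abbrev Uf : S.Ef.Opens := S.E.map S.jf.hom ⁻¹ᵁ S.VC

/-- `X'_f`, the base change of `X'₀` to `k(tf)`. [folklore] -/
abbrev Xf : Scheme.{u} := S.DX.obj S.tf

/-- The leg at the final stage, `X̄̄₁ → E_f`. [folklore] -/
abbrev legEf : S.Xbar₁ ⟶ S.Ef := S.legE S.tf

/-- The leg at the final stage, `X̄' → X'_f`. [folklore] -/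
abbrev legXf : S.Xb ⟶ S.Xf := S.legXb S.tf

/-- The transition map `U_f → U_{jD}` of the diagram of preimages. [folklore] -/
def trD : S.OD.obj S.jf ⟶ S.OD.obj S.jD := S.OD.map S.jfD

/-- `U_f → U_{jD} → X'₀`. [folklore] -/
def gf : S.OD.obj S.jf ⟶ S.X'₀ := S.trD ≫ S.gD

/-- `gf` is a `k₀`-morphism: `gf ≫ qX₀ = U_f ⊆ E_f → Spec k(tf) → Spec k₀`. [folklore] -/
theorem gf_qX₀ : S.gf ≫ S.qX₀ =
    S.Uf.ι ≫ S.qE S.tf ≫ Spec.map ((stageNat k K S.t₀).app S.tf.unop) := by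
  have h1 : S.trD ≫ S.t₂.app S.jD = S.t₂.app S.jf := by
    have := S.t₂.naturality S.jfD
    erw [Category.comp_id] at this
    exact this
  rw [gf, Category.assoc, S.gD_qX₀, h1, S.t₂_app]
  exact congrArg (S.Uf.ι ≫ ·)
    (pullback.condition (f := Spec.map ((stageNat k K S.t₀).app S.tf.unop)) (g := S.q₀)).symm

/-- **The descended morphism `φ_f : U_f → X'_f`** over `k(tf)`: the pair
(`U_f → Spec k(tf)`, `U_f → U_{jD} → X'₀`). [cite: DeJong1996, 4.5, p. 66] -/
def φf : (S.Uf : Scheme.{u}) ⟶ S.Xf :=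
  pullback.lift (S.Uf.ι ≫ S.qE S.tf) S.gf ((Category.assoc _ _ _).trans S.gf_qX₀.symm)

/-- `φ_f` is a `k(tf)`-morphism. [folklore] -/
@[reassoc]
theorem φf_qX : S.φf ≫ S.qX S.tf = S.Uf.ι ≫ S.qE S.tf := pullback.lift_fst _ _ _

/-- `φ_f` followed by `X'_f → X'₀` is `gf`. [folklore] -/
@[reassoc]
theorem φf_snd : S.φf ≫ pullback.snd (Spec.map ((stageNat k K S.t₀).app S.tf.unop)) S.qX₀ = S.gf :=
  pullback.lift_snd _ _ _

/-! ## The upstairs open `legE⁻¹ U_f = j₁(X₁)` -/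

/-- The preimage of `U_f` in `E_K` is `V̄`. [folklore] -/
theorem leg_preimage_Uf : S.leg S.tf ⁻¹ᵁ S.Uf = S.Vpre :=
  preimage_map_preimage S.E S.cE S.jf.hom S.VC

/-- `legE = e₁ ≫ leg` (by `rfl`). [folklore] -/
theorem legEf_eq : S.legEf = S.e₁.hom ≫ S.leg S.tf := rfl

/-- The preimage of `U_f` in `X̄̄₁` is `j₁(X₁)`. [folklore] -/
theorem preimage_Uf : S.legEf ⁻¹ᵁ S.Uf = S.j₁.opensRange := by
  rw [S.legEf_eq, Scheme.Hom.comp_preimage, S.leg_preimage_Uf, S.preimage_VC,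
    ← Scheme.Hom.comp_preimage, Iso.hom_inv_id]
  rfl

/-- The isomorphism `Θ : legE⁻¹ U_f ≅ X₁`. [folklore] -/
def Θ : (S.legEf ⁻¹ᵁ S.Uf : Scheme.{u}) ≅ S.X₁ :=
  S.Xbar₁.isoOfEq S.preimage_Uf ≪≫ S.j₁.isoOpensRange.symm

/-- `Θ ≫ j₁` is the inclusion. [folklore] -/
@[reassoc]
theorem Θ_hom_j₁ : S.Θ.hom ≫ S.j₁ = (S.legEf ⁻¹ᵁ S.Uf).ι := by
  simp only [Θ, Iso.trans_hom, Iso.symm_hom, Category.assoc, Scheme.Hom.isoOpensRange_inv_comp,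
    Scheme.isoOfEq_hom_ι]

/-- `Ψ⁻¹` followed by the inclusion of `V̄` in `E_K` is `j₁ ≫ e₁`. [folklore] -/
@[reassoc]
theorem Ψ_inv_ι : S.Ψ.inv ≫ S.Vpre.ι = S.j₁ ≫ S.e₁.hom := by
  have h1 : S.VbarIso.inv ≫ S.Vbar.ι = S.j₁ ≫ S.e₁.hom := by
    rw [Iso.inv_comp_eq, S.VbarIso_hom_j₁_assoc, Iso.inv_hom_id, Category.comp_id]
  simp only [Ψ, Iso.trans_inv, Category.assoc, Scheme.isoOfEq_inv_ι, h1]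

/-- The alteration transported to the upstairs open: `φ₁' = Θ ≫ φ₁`. [folklore] -/
abbrev φ₁' : (S.legEf ⁻¹ᵁ S.Uf : Scheme.{u}) ⟶ S.Xb := S.Θ.hom ≫ S.φ₁

/-- **Key identity**: the restriction `legE⁻¹ U_f → U_f` of the leg is `Θ ≫ Ψ⁻¹ ≫ (cone leg)`.
[folklore] -/
theorem restrict_legEf : S.legEf ∣_ S.Uf = S.Θ.hom ≫ S.Ψ.inv ≫ S.ocone.π.app S.jf := by
  rw [← cancel_mono S.Uf.ι]
  rw [morphismRestrict_ι, Category.assoc, Category.assoc]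
  have h1 : S.ocone.π.app S.jf ≫ S.Uf.ι = S.Vpre.ι ≫ S.leg S.tf := Scheme.Hom.resLE_comp_ι _ _
  rw [h1, S.Ψ_inv_ι_assoc, S.Θ_hom_j₁_assoc, S.legEf_eq]

/-- `φ₁'` lies over `Spec K` compatibly with the leg. [folklore] -/
theorem φ₁'_gb : S.φ₁' ≫ S.gb = (S.legEf ⁻¹ᵁ S.Uf).ι ≫ S.g := by
  have h2 : S.φ₁ ≫ S.gb = S.j₁ ≫ S.g := by rw [S.w]
  rw [Category.assoc, h2, S.Θ_hom_j₁_assoc]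

/-- `X̄' → X'_f → X'₀` is `X̄' → X'₀`. [folklore] -/
theorem legXf_snd : S.legXf ≫ pullback.snd (Spec.map ((stageNat k K S.t₀).app S.tf.unop)) S.qX₀ =
    S.toX'₀ := by
  have h : (S.cX.π.app S.tf : S.cX.pt ⟶ S.DX.obj S.tf) ≫
      pullback.snd (Spec.map ((stageNat k K S.t₀).app S.tf.unop)) S.qX₀ =
      pullback.snd (Spec.map S.σ₂) S.qX₀ :=
    schemeCone_π_app_snd k K S.t₀ S.k₀ (stageNat k K S.t₀) S.σ₂ (stageNat_ι k K S.t₀) S.X'O S.tf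
  have h2 : S.legXf = S.eb.hom ≫ (S.cX.π.app S.tf : S.cX.pt ⟶ S.DX.obj S.tf) := rfl
  rw [h2, Category.assoc]
  exact (congrArg (S.eb.hom ≫ ·) h).trans S.eb_hom_snd

/-- **The square commutes**: `φ₁' ≫ (X̄' → X'_f) = (legE⁻¹ U_f → U_f) ≫ φ_f`. [folklore] -/
theorem φ₁'_legXf : S.φ₁' ≫ S.legXf = (S.legEf ∣_ S.Uf) ≫ S.φf := by
  apply pullback.hom_ext
  · -- over `Spec k(tf)`
    have h1 : S.legXf ≫ S.qX S.tf = S.gb ≫ S.sK S.tf := (S.isPullback_legXb S.tf).w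
    have h2 : S.legEf ≫ S.qE S.tf = S.g ≫ S.sK S.tf := (S.isPullback_legE S.tf).w
    calc (S.φ₁' ≫ S.legXf) ≫ S.qX S.tf = S.φ₁' ≫ (S.legXf ≫ S.qX S.tf) := Category.assoc _ _ _
      _ = S.φ₁' ≫ S.gb ≫ S.sK S.tf := by rw [h1]
      _ = (S.legEf ⁻¹ᵁ S.Uf).ι ≫ S.g ≫ S.sK S.tf := by rw [← Category.assoc, S.φ₁'_gb, Category.assoc]
      _ = (S.legEf ⁻¹ᵁ S.Uf).ι ≫ S.legEf ≫ S.qE S.tf := by rw [h2]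
      _ = (S.legEf ∣_ S.Uf) ≫ S.Uf.ι ≫ S.qE S.tf := by rw [← morphismRestrict_ι_assoc]
      _ = (S.legEf ∣_ S.Uf) ≫ (S.φf ≫ S.qX S.tf) := by rw [S.φf_qX]
      _ = ((S.legEf ∣_ S.Uf) ≫ S.φf) ≫ S.qX S.tf := (Category.assoc _ _ _).symm
  · -- over `X'₀`
    have h2 : S.ocone.π.app S.jf ≫ S.gf = S.aD := by
      change S.ocone.π.app S.jf ≫ S.OD.map S.jfD ≫ S.gD = S.aD
      rw [← Category.assoc, S.ocone.w S.jfD, S.ocone_π_gD]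
    have h3 : (S.legEf ∣_ S.Uf) ≫ S.gf = S.Θ.hom ≫ S.Ψ.inv ≫ S.aD := by
      rw [S.restrict_legEf, Category.assoc, Category.assoc]
      exact congrArg (S.Θ.hom ≫ ·) (congrArg (S.Ψ.inv ≫ ·) h2)
    calc (S.φ₁' ≫ S.legXf) ≫ pullback.snd _ _ = S.φ₁' ≫ (S.legXf ≫ pullback.snd _ _) :=
          Category.assoc _ _ _
      _ = S.φ₁' ≫ S.toX'₀ := congrArg (S.φ₁' ≫ ·) S.legXf_snd
      _ = S.Θ.hom ≫ S.φ₁ ≫ S.toX'₀ := Category.assoc _ _ _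
      _ = S.Θ.hom ≫ S.Ψ.inv ≫ (S.Ψ.hom ≫ S.φ₁ ≫ S.toX'₀) := by rw [S.Ψ.inv_hom_id_assoc]
      _ = S.Θ.hom ≫ S.Ψ.inv ≫ S.aD := by rw [S.aD_eq]
      _ = (S.legEf ∣_ S.Uf) ≫ S.gf := h3.symm
      _ = (S.legEf ∣_ S.Uf) ≫ (S.φf ≫ pullback.snd _ _) :=
          (congrArg ((S.legEf ∣_ S.Uf) ≫ ·) S.φf_snd).symm
      _ = ((S.legEf ∣_ S.Uf) ≫ S.φf) ≫ pullback.snd _ _ := (Category.assoc _ _ _).symm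

/-- For `K/k` algebraic the subalgebras `k(t) = k[t]` are fields; we register the field structure
(extending the given ring structure, `IsField.toField`) as an instance, to feed the stage lemmas
of `AlterationsDescentStage.lean`. [folklore] -/
instance instFieldFld [Algebra.IsAlgebraic k K] (t : Finset K) : Field (fld k K t) :=
  (isField_fld k K t).toField

/-- The inclusion `k(tf) ⊆ K`. [folklore] -/
def σf : (fld k K S.tf.unop.1) →+* K := (fld k K S.tf.unop.1).val.toRingHom

/-- `Spec K → Spec k(tf)` is `Spec σf` (by `rfl`). [folklore] -/
theorem sKf_eq : S.sK S.tf = Spec.map (CommRingCat.ofHom S.σf) := rfl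

/-- The leg square for `E` at the final stage, over `Spec σf`. [folklore] -/
theorem hEf : IsPullback S.legEf S.g (S.qE S.tf) (Spec.map (CommRingCat.ofHom S.σf)) :=
  S.isPullback_legE S.tf

/-- The leg square for `X'` at the final stage, over `Spec σf`. [folklore] -/
theorem hXf : IsPullback S.legXf S.gb (S.qX S.tf) (Spec.map (CommRingCat.ofHom S.σf)) :=
  S.isPullback_legXb S.tf

variable [Algebra.IsAlgebraic k K]

/-- **The square `(legE⁻¹U_f → U_f, φ₁', φ_f, X̄' → X'_f)` is cartesian.** [folklore] -/
theorem isPullback_φf : IsPullback S.φ₁' (S.legEf ∣_ S.Uf) S.legXf S.φf :=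
  Stage.isPullback_restrict S.σf S.hEf S.hXf S.Uf S.φf_qX S.φ₁'_gb S.φ₁'_legXf

/-! ## Consequences at the final stage -/

/-- `X̄̄₁ → E_f` is surjective. [folklore] -/
instance surjective_legEf : Surjective S.legEf :=
  Stage.surjective_leg S.σf S.hEf

/-- `X̄̄₁ → E_f` is flat. [folklore] -/
instance flat_legEf : Flat S.legEf := Stage.flat_leg S.σf S.hEf

/-- `X̄̄₁ → E_f` is affine. [folklore] -/
instance isAffineHom_legEf : IsAffineHom S.legEf :=
  Stage.isAffineHom_leg S.σf S.hEf

/-- `X̄' → X'_f` is surjective. [folklore] -/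
instance surjective_legXf : Surjective S.legXf :=
  Stage.surjective_leg S.σf S.hXf

/-- `X̄' → X'_f` is flat. [folklore] -/
instance flat_legXf : Flat S.legXf := Stage.flat_leg S.σf S.hXf

/-- `E_f` is integral. [cite: DeJong1996, 4.5, p. 66] -/
instance isIntegral_Ef : IsIntegral S.Ef := Stage.isIntegral_of_flat_surjective S.legEf

/-- `X'_f` is integral. [cite: DeJong1996, 4.5, p. 66] -/
instance isIntegral_Xf : IsIntegral S.Xf := Stage.isIntegral_of_flat_surjective S.legXf

/-- `k(tf)` is a Noetherian ring. [folklore] -/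
instance isNoetherianRing_kf : IsNoetherianRing S.kf := by
  haveI : Algebra.FiniteType k (fld k K S.tf.unop.1) :=
    (Subalgebra.fg_iff_finiteType _).mp (Subalgebra.fg_adjoin_finset _)
  exact Algebra.FiniteType.isNoetherianRing k (fld k K S.tf.unop.1)

/-- `Spec k(tf)` is locally Noetherian. [folklore] -/
instance isLocallyNoetherian_Spec_kf : IsLocallyNoetherian (Spec S.kf) := inferInstance

/-- `E_f` is locally Noetherian. [folklore] -/
instance isLocallyNoetherian_Ef : IsLocallyNoetherian S.Ef :=
  LocallyOfFiniteType.isLocallyNoetherian (S.qE S.tf)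

/-- **`E_f` is regular.** [cite: DeJong1996, 4.5, p. 66] -/
theorem isRegular_Ef : Scheme.IsRegular S.Ef :=
  Stage.isRegular_of_flat_surjective S.legEf S.isRegular_Xbar₁

/-- `U_f` is non-empty. [folklore] -/
instance nonempty_Uf : Nonempty S.Uf := by
  haveI := S.isAlteration_φ₁.isIntegral
  exact ⟨(S.legEf ∣_ S.Uf) (S.Θ.inv (Classical.arbitrary S.X₁))⟩

/-- `U_f` is integral. [folklore] -/
instance isIntegral_Uf : IsIntegral S.Uf := isIntegral_of_isOpenImmersion S.Uf.ι

omit [Algebra.IsAlgebraic k K] in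
/-- `φ₁'` is an alteration. [folklore] -/
theorem isAlteration_φ₁' : IsAlteration S.φ₁' := isAlteration_iso_comp S.Θ.hom S.isAlteration_φ₁

/-- `φ₁'` is proper. [folklore] -/
instance isProper_φ₁' : IsProper S.φ₁' := S.isAlteration_φ₁'.isProper

/-- **`φ_f` is an alteration.** [cite: DeJong1996, 4.5, p. 66] -/
theorem isAlteration_φf : IsAlteration S.φf :=
  Stage.isAlteration_of_isPullback S.σf S.hEf S.hXf S.Uf S.φf_qX S.φ₁'_gb S.φ₁'_legXf
    S.isAlteration_φ₁'

/-! ## Generic étaleness of `φ_f` -/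

/-- The descended étale locus at the final stage, an open of `U_f`. [folklore] -/
abbrev Wf : (S.Uf : Scheme.{u}).Opens := S.OD.map S.jfE ⁻¹ᵁ S.WE

omit [Algebra.IsAlgebraic k K] in
/-- The preimage of `W_f` upstairs is `Θ⁻¹(W₁)`. [folklore] -/
theorem preimage_Wf : (S.legEf ∣_ S.Uf) ⁻¹ᵁ S.Wf = S.Θ.hom ⁻¹ᵁ S.W₁ := by
  have h1 : (S.ocone.π.app S.jf ≫ S.OD.map S.jfE) ⁻¹ᵁ S.WE = S.Wpre := by
    rw [S.ocone.w S.jfE, S.preimage_WE]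
  have h2 : S.ocone.π.app S.jf ⁻¹ᵁ S.Wf = S.Ψ.hom ⁻¹ᵁ S.W₁ := by
    rw [← Scheme.Hom.comp_preimage]; exact h1
  have h3 : (S.Ψ.inv ≫ S.ocone.π.app S.jf) ⁻¹ᵁ S.Wf = S.W₁ := by
    rw [Scheme.Hom.comp_preimage, h2, ← Scheme.Hom.comp_preimage, Iso.inv_hom_id]; rfl
  rw [S.restrict_legEf, Scheme.Hom.comp_preimage, h3]

/-- `φ_f` is étale on `W_f`. [folklore] -/
theorem etale_Wf : Etale (S.Wf.ι ≫ S.φf) := by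
  have sq := S.isPullback_φf
  have hq := Stage.fpqc_leg S.σf S.hXf
  -- restrict the cartesian square to `W_f`
  have sqW : IsPullback (((S.legEf ∣_ S.Uf) ⁻¹ᵁ S.Wf).ι ≫ S.φ₁') ((S.legEf ∣_ S.Uf) ∣_ S.Wf)
      S.legXf (S.Wf.ι ≫ S.φf) :=
    (isPullback_morphismRestrict (S.legEf ∣_ S.Uf) S.Wf).flip.paste_horiz sq
  -- upstairs: `Θ⁻¹(W₁) ≅ W₁ → X₁ → X̄'` is étale
  haveI : Etale (((S.legEf ∣_ S.Uf) ⁻¹ᵁ S.Wf).ι ≫ S.φ₁') := by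
    have h1 : ((S.legEf ∣_ S.Uf) ⁻¹ᵁ S.Wf).ι ≫ S.φ₁' =
        ((S.legEf ⁻¹ᵁ S.Uf : Scheme.{u}).isoOfEq S.preimage_Wf).hom ≫ (S.Θ.hom ∣_ S.W₁) ≫
          S.W₁.ι ≫ S.φ₁ := by
      rw [morphismRestrict_ι_assoc, Scheme.isoOfEq_hom_ι_assoc]
    rw [h1]
    haveI := S.etale_W₁
    infer_instance
  exact MorphismProperty.of_isPullback_of_descendsAlong (P := @Etale)
    (Q := (@Surjective ⊓ @Flat ⊓ @QuasiCompact : MorphismProperty Scheme.{u})) sqW hq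
    inferInstance

omit [Algebra.IsAlgebraic k K] in
/-- Membership in the preimage of an open (by `Iff.rfl`; used to keep kernel checking cheap).
[folklore] -/
theorem mem_preimage_iff {A B : Scheme.{u}} (f : A ⟶ B) (U : B.Opens) (a : A) :
    a ∈ f ⁻¹ᵁ U ↔ f a ∈ U := Iff.rfl

omit [Algebra.IsAlgebraic k K] in
/-- `W_f` is non-empty: it contains the image of any point of `W₁`. [folklore] -/
theorem nonempty_Wf : (S.Wf : Set S.Uf).Nonempty := by
  haveI := S.isAlteration_φ₁.isIntegral
  obtain ⟨x, hx⟩ := S.dense_W₁.nonempty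
  have h1 : S.Θ.hom (S.Θ.inv x) = x := by
    rw [← Scheme.Hom.comp_apply, Iso.inv_hom_id]
    rfl
  have h2 : S.Θ.inv x ∈ (S.legEf ∣_ S.Uf) ⁻¹ᵁ S.Wf := by
    rw [S.preimage_Wf, mem_preimage_iff, h1]
    exact hx
  exact ⟨(S.legEf ∣_ S.Uf) (S.Θ.inv x), (mem_preimage_iff _ _ _).mp h2⟩

/-- **`φ_f` is generically étale.** [cite: DeJong1996, 4.5, p. 66] -/
theorem isGenericallyEtale_φf : IsGenericallyEtale S.φf :=
  ⟨S.Wf, S.Wf.2.dense S.nonempty_Wf, S.etale_Wf⟩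

end Setup



end DeJong1996.Descent45

end Literature.AlgebraicGeometry.Resolution

end
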